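import Literature.Probability.LatticeModels.LayeredPlaneRotatorStackStiffness
import Literature.Probability.LatticeModels.PlaneRotatorTransitionCouplings
import HarnessLib

/-!
# The decoupled stack, the infinite-volume stack stiffness `Υ^{3D}_∞` and the stiffness transition
# coupling `K_Υ^{3D}(Δ)` of the layered plane rotator: `βΥ^{3D}_L(K∥, K⊥ = 0) = βΥ^{2D}_L(K∥)` at every `L`,
# `K_χ^{3D}(Δ) ≤ K_Υ^{3D}(Δ)` for every `Δ ≥ 0`, and `K_Υ^{3D}(0) = K_Υ`

Topic `Literature/Probability/LatticeModels`. Companion of `LayeredPlaneRotatorStackStiffness.lean` (p588380: the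
directional helicity modulus `torusXYDirStiffness L K i` of `torusXY d L` at direction-dependent couplings, its
cut–cut covariance, and `βΥ^{3D}_{L,i} → 0` wherever one cube number is `< 1`), of
`PlaneRotatorStiffnessLiminf.lean` (p584739: `Υ_∞(K) = liminf_L βΥ_{L+1}(K)` of ONE layer) and of
`PlaneRotatorTransitionCouplings.lean` (p588809: `K_χ(ν)`, `K_Υ`, `K_χ^{3D}(Δ)`).

## Contents

* §1 **The decoupled stack** (every dimension `d`, zero coupling on the last direction). The sites of
  `(ℤ/Lℤ)^{d+1}` are `Fin.snoc y k` (`y ∈ (ℤ/Lℤ)^d` the in-layer position, `k ∈ ℤ/L` the layer); moving along an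
  in-layer direction stays in the layer (`snoc_add_single_castSucc`); for the couplings `Fin.snoc K 0` (`K_m` on the
  in-layer directions, `0` between the layers) the Hamiltonian of `torusXY (d+1) L` is the SUM of the layer
  Hamiltonians of `torusXY d L` at couplings `K` (`torusXY_hamiltonian_stack`), the Gibbs weight is the PRODUCT of the
  layer weights (`torusXY_weightJ_stack`), the Haar product measure of the stack is the product of the layer Haar
  measures under `θ ↦ (k ↦ θ|_{layer k})` (`integral_torusHaar_stack`: Mathlib's `measurePreserving_piCongrLeft` and
  `Measure.infinitePi_map_curry`), hence **Gibbs expectations of layer-wise products factorise**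
  (`torusXY_expectJ_stack_prod`; one layer: `torusXY_expectJ_stack_layer`; two layers:
  `torusXY_expectJ_stack_layer_mul_layer` — the layers are independent copies of the `d`-dimensional model).
* §2 **The stack's in-layer helicity modulus is the layer's**: the twist current of the uniform `e_i`-twist is the sum
  of the layer currents, the energy term is `L` times the layer's, the cross-layer current covariances vanish, so
  `Q^{(d+1)}(snoc K 0; e_i) = L · Q^{(d)}(K; e_i)` (`torusXY_twistModulus_stack`) and
  **`torusXYDirStiffness L (Fin.snoc K 0) (castSucc i) = torusXYDirStiffness L K i`** (every `L`, `d`, `i`), while the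
  modulus across the layers vanishes identically (`torusXYDirStiffness_stack_last`). For the layered rotator on
  `(ℤ/Lℤ)³` (`AnisotropicRotator.layeredCoupling K∥ K⊥ = (K∥, K∥, K⊥)`) at `K⊥ = 0`:
  **`βΥ^{3D}_{L,e₁}(K∥, 0) = βΥ^{2D}_L(K∥) = torusXYStiffness L K∥`** (`torusXYDirStiffness_layered_zero_eq_torusXYStiffness`)
  and `βΥ^{3D}_{L,e₃}(K∥, 0) = 0`.
* §3 **`Υ^{3D}_∞(K∥, K⊥, i) := liminf_L βΥ^{3D}_{L+1,i}(K∥, K∥, K⊥)`** (`AnisotropicRotator.layeredStiffnessLiminf`, the twin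
  of `torusXYStiffnessLiminf`): `0 ≤ Υ^{3D}_∞ ≤ K_i`; `= 0` wherever one cube number is `< 1`, wherever the free
  two-point function is summable / the periodic susceptibility is bounded, throughout Lieb's star region and the
  weak-interlayer windows of record; `Υ^{3D}_∞ > 0 ⇒ ∑_z G^{3D}(0, z) = ∞`; and at `K⊥ = 0`:
  `Υ^{3D}_∞(K, 0, e₁) = Υ_∞(K)`, `Υ^{3D}_∞(K, 0, e₃) = 0`.
* §4 **`K_Υ^{3D}(Δ, i) := inf {K ≥ 0 : Υ^{3D}_∞(K, ΔK, i) > 0}`** (`AnisotropicRotator.layeredStiffnessCriticalCoupling`),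
  beside `K_χ^{3D}(Δ)` of p588809: **`K_χ^{3D}(Δ) ≤ K_Υ^{3D}(Δ, i)` for every `Δ ≥ 0` and every twist direction**
  (`T_Υ^{3D}(J∥, J⊥) ≤ T_χ^{3D}(J∥, J⊥)`: the stiffness onset of the stack lies at or below its susceptibility
  transition temperature), **`K_Υ^{3D}(0, e₁) = K_Υ`** (the decoupled stack's in-plane stiffness transition IS the
  layer's), `K_Υ^{3D}(0, e₃) = ∞`, the isotropic point `K_χ(3) ≤ K_Υ^{3D}(1, i)`, the weak-interlayer limit
  **`K_χ(2) ≤ liminf_{Δ → 0⁺} K_Υ^{3D}(Δ, i)`** (`limsup_{J⊥ → 0⁺} T_Υ^{3D}(J∥, J⊥) ≤ T_χ^{2D}(J∥)`), and the floors of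
  record by name (`2β_c(2)`, `log(1+√2)` at `Δ = 0`; `2β_c(3)` for `0 ≤ Δ ≤ 1`; Lieb's star region at every `Δ`).

All PROVED (two `ℝ`/`ℝ≥0∞`-valued objects, no named fact, no numerics). Cell `pub/hubbard-tc` (MO-S3; G2 2D→3D
ordering lemma in stiffness currency), classical layered comparison model only, number-neutral. WHAT THIS IS NOT:
no monotonicity or continuity of `Υ^{3D}` in `K⊥ > 0` (no correlation inequality orders a helicity modulus in the
couplings), not `Υ^{3D}_∞ > 0` anywhere, not `K_Υ^{3D} = K_χ^{3D}`; never a Hubbard-model or material statement.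

## References

* M. E. Fisher, M. N. Barber, D. Jasnow, Phys. Rev. A 8 (1973) 1111, §II eqs. (2.3)–(2.5) (helicity modulus,
  twisted ensemble). [FisherBarberJasnow1973]
* L. L. Liu, H. E. Stanley, Phys. Rev. Lett. 29 (1972) 927, p. 272 of the reprint pagination used in the tree
  (layers `(J, J, εJ)`; `ε = 0` = independent layers). [LiuStanley1972]
* J. Ginibre, Comm. Math. Phys. 16 (1970) 310, Example 4 (plane rotators). [Ginibre1970]
* B. Simon, Comm. Math. Phys. 77 (1980) 111, Thm 1.3; E. H. Lieb, ibid. 127, Theorem 4 and p. 128. [Simon1980CMP] [Lieb1980]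

Tree: `torusXY`, `BondSystem.bondChar(_apply)/bondVar_one/weightJ/partitionFnJ/expectJ(_eq)/twistCurrent/twistModulus`,
`expectJ_twistCurrent_eq_zero`, `continuous_twistCurrent`, `BondSystem.expectJ_finset_sum`, `axisProfile`,
`torusXYDirStiffness(_two/_nonneg/_le_coupling)`, `torusXYStiffness(Liminf)`, `stiffnessCriticalCoupling`,
`PlaneRotator.layeredSusceptibilityCriticalCoupling(_le_ofReal_of_not_summable)`, the `AnisotropicRotator.tendsto_…`
family of p588380. Mathlib: `Fin.snocEquiv`, `MeasurableEquiv.piCongrLeft/curry`, `measurePreserving_piCongrLeft`,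
`Measure.infinitePi_map_curry`, `Measure.infinitePi_eq_pi`, `integral_fintype_prod_eq_prod`, `Filter.liminf`.
-/

noncomputable section

open MeasureTheory Finset Filter
open scoped BigOperators Topology ENNReal

namespace Literature.Probability.LatticeModels

open PlaneRotator Literature.Barriers.CriticalPhenomena Literature.Barriers.CriticalPhenomena.LongRangeIsing

variable {d L : ℕ}

/-! ## §1 The decoupled stack: sites, energy, weight, measure, expectations -/

section Stack

/-- **In-layer steps stay in the layer**: the stack site above `y` in layer `k` is `Fin.snoc y k` (coordinates
`(y₀, …, y_{d−1}, k)`), and `Fin.snoc y k + e_{castSucc m} = Fin.snoc (y + e_m) k` (lattice bookkeeping for the layered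
model). [cite: LiuStanley1972, p. 272 (layers (J, J, εJ): in-plane bonds stay in the layer) — bookkeeping] -/
theorem snoc_add_single_castSucc (y : TorusSite d L) (k : ZMod L) (m : Fin d) :
    (Fin.snoc y k : TorusSite (d + 1) L) + Pi.single (Fin.castSucc m) 1 = Fin.snoc (y + Pi.single m 1) k := by
  funext j
  refine Fin.lastCases ?_ (fun j' => ?_) j
  · rw [Pi.add_apply, Fin.snoc_last, Fin.snoc_last, Pi.single_apply, if_neg (Fin.castSucc_lt_last m).ne', add_zero]
  · rw [Pi.add_apply, Fin.snoc_castSucc, Fin.snoc_castSucc, Pi.add_apply, Pi.single_apply, Pi.single_apply]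
    simp only [Fin.castSucc_inj]

/-- **A bond sum over the stack with nothing on the inter-layer bonds is a sum of layer bond sums**:
`∑_{(x, n)} F(x, n) = ∑_k ∑_{(y, m)} F(snoc y k, castSucc m)` whenever `F(x, last) = 0`.
[cite: LiuStanley1972, p. 272 (layers (J, J, εJ), ε = 0: only in-plane bonds) — bookkeeping] -/
theorem sum_bonds_stack [NeZero L] {M : Type*} [AddCommMonoid M] (F : TorusSite (d + 1) L × Fin (d + 1) → M)
    (hlast : ∀ x, F (x, Fin.last d) = 0) :
    ∑ b, F b = ∑ k : ZMod L, ∑ b : TorusSite d L × Fin d, F (Fin.snoc b.1 k, Fin.castSucc b.2) := by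
  rw [Fintype.sum_prod_type]
  simp_rw [Fin.sum_univ_castSucc, hlast, add_zero]
  rw [← Fintype.sum_equiv (Fin.snocEquiv fun _ : Fin (d + 1) => ZMod L)
    (fun p => ∑ m : Fin d, F (Fin.snoc p.2 p.1, Fin.castSucc m)) (fun x => ∑ m : Fin d, F (x, Fin.castSucc m))
    (fun p => rfl), Fintype.sum_prod_type]
  exact Finset.sum_congr rfl fun k _ => by rw [Fintype.sum_prod_type]

/-- **The bond character of an in-layer bond of the stack is the layer's bond character of the restricted
configuration**: `χ_{(snoc y k, castSucc m)}(θ) = χ_{(y, m)}(θ|_{layer k})`.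
[cite: Ginibre1970, Example 4 (plane rotators: bond characters); LiuStanley1972, p. 272 (layers) — bookkeeping] -/
theorem torusXY_bondChar_stack (θ : TorusSite (d + 1) L → Circle) (k : ZMod L) (y : TorusSite d L) (m : Fin d) :
    (torusXY (d + 1) L).bondChar (Fin.snoc y k, Fin.castSucc m) θ =
      (torusXY d L).bondChar (y, m) (fun y' => θ (Fin.snoc y' k)) := by
  rw [BondSystem.bondChar_apply, BondSystem.bondChar_apply, BondSystem.bondVar_one, BondSystem.bondVar_one]
  show (θ (Fin.snoc y k))⁻¹ * θ (Fin.snoc y k + Pi.single (Fin.castSucc m) 1) =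
    (θ (Fin.snoc y k))⁻¹ * θ (Fin.snoc (y + Pi.single m 1) k)
  rw [snoc_add_single_castSucc]

/-- `Re χ_{(snoc y k, castSucc m)}(θ) = Re χ_{(y, m)}(θ|_{layer k})` (the bond cosine).
[cite: Ginibre1970, Example 4 (plane rotators: cos of the bond angle); LiuStanley1972, p. 272 (layers) — bookkeeping] -/
theorem torusXY_reChar_bondChar_stack (θ : TorusSite (d + 1) L → Circle) (k : ZMod L) (y : TorusSite d L)
    (m : Fin d) :
    reChar ((torusXY (d + 1) L).bondChar (Fin.snoc y k, Fin.castSucc m)) θ =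
      reChar ((torusXY d L).bondChar (y, m)) (fun y' => θ (Fin.snoc y' k)) := by
  rw [reChar, reChar, torusXY_bondChar_stack]

/-- `Im χ_{(snoc y k, castSucc m)}(θ) = Im χ_{(y, m)}(θ|_{layer k})` (the bond sine).
[cite: Ginibre1970, Example 4 (plane rotators: sin of the bond angle); LiuStanley1972, p. 272 (layers) — bookkeeping] -/
theorem torusXY_imChar_bondChar_stack (θ : TorusSite (d + 1) L → Circle) (k : ZMod L) (y : TorusSite d L)
    (m : Fin d) :
    imChar ((torusXY (d + 1) L).bondChar (Fin.snoc y k, Fin.castSucc m)) θ =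
      imChar ((torusXY d L).bondChar (y, m)) (fun y' => θ (Fin.snoc y' k)) := by
  rw [imChar, imChar, torusXY_bondChar_stack]

variable [NeZero L]

/-- **The energy of the decoupled stack is the sum of the layer energies**: for the couplings `Fin.snoc K 0`
(`K_m` on the in-layer direction `m`, `0` between the layers),
`∑_{(x,n)} (snoc K 0)_n cos ∇θ_{(x,n)} = ∑_k ∑_{(y,m)} K_m cos ∇(θ|_{layer k})_{(y,m)}`.
[cite: LiuStanley1972, p. 272 (layers (J, J, εJ); ε = 0 decouples the layers)] -/
theorem torusXY_hamiltonian_stack (K : Fin d → ℝ) (θ : TorusSite (d + 1) L → Circle) :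
    ginibreHamiltonian (torusXY (d + 1) L).bondChar
        (fun b => (Fin.snoc K 0 : Fin (d + 1) → ℝ) b.2) θ =
      ∑ k : ZMod L, ginibreHamiltonian (torusXY d L).bondChar (fun b => K b.2) (fun y => θ (Fin.snoc y k)) := by
  unfold ginibreHamiltonian
  rw [sum_bonds_stack (fun b => (Fin.snoc K 0 : Fin (d + 1) → ℝ) b.2 * reChar ((torusXY (d + 1) L).bondChar b) θ)
    (fun x => by simp only [Fin.snoc_last, zero_mul])]
  refine Finset.sum_congr rfl fun k _ => Finset.sum_congr rfl fun b _ => ?_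
  simp only [Fin.snoc_castSucc, torusXY_reChar_bondChar_stack]

/-- **The Gibbs weight of the decoupled stack is the product of the layer weights.**
[cite: LiuStanley1972, p. 272 (layers (J, J, εJ); ε = 0 decouples the layers)] -/
theorem torusXY_weightJ_stack (K : Fin d → ℝ) (θ : TorusSite (d + 1) L → Circle) :
    (torusXY (d + 1) L).weightJ (fun b => (Fin.snoc K 0 : Fin (d + 1) → ℝ) b.2) θ =
      ∏ k : ZMod L, (torusXY d L).weightJ (fun b => K b.2) (fun y => θ (Fin.snoc y k)) := by
  simp only [BondSystem.weightJ, ginibreWeight]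
  rw [torusXY_hamiltonian_stack, Real.exp_sum]

variable [MeasurableSpace Circle] [BorelSpace Circle]

/-- **The Haar measure of the stack is the product of the layer Haar measures**: under
`θ ↦ (k ↦ θ|_{layer k})`, `∫ F(θ|_{layer ·}) dθ^{(ℤ/L)^{d+1}} = ∫ F dΘ` with `dΘ = ⊗_k dθ^{(ℤ/L)^d}` (Fubini on the
product Haar measure: Mathlib `measurePreserving_piCongrLeft` for the site relabelling `Fin.snocEquiv` and
`Measure.infinitePi_map_curry` for the currying).
[cite: LiuStanley1972, p. 272 (ε = 0: independent layers — the a priori measure is the product over layers); Ginibre1970, Example 4 (Haar a priori measure of the plane rotator) — plumbing] -/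
theorem integral_torusHaar_stack (F : (ZMod L → TorusSite d L → Circle) → ℝ) :
    ∫ θ, F (fun k y => θ (Fin.snoc y k)) ∂torusHaar (TorusSite (d + 1) L) =
      ∫ Θ, F Θ ∂(Measure.pi fun _ : ZMod L => torusHaar (TorusSite d L)) := by
  set μ : Measure Circle := Measure.haarMeasure (⊤ : TopologicalSpace.PositiveCompacts Circle) with hμ
  let σ : ZMod L × TorusSite d L ≃ TorusSite (d + 1) L := Fin.snocEquiv fun _ : Fin (d + 1) => ZMod L
  let Φ : (TorusSite (d + 1) L → Circle) ≃ᵐ (ZMod L → TorusSite d L → Circle) :=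
    (MeasurableEquiv.piCongrLeft (fun _ : TorusSite (d + 1) L => Circle) σ).symm.trans
      (MeasurableEquiv.curry (ZMod L) (TorusSite d L) Circle)
  have h1 : MeasurePreserving (MeasurableEquiv.piCongrLeft (fun _ : TorusSite (d + 1) L => Circle) σ)
      (Measure.pi fun _ : ZMod L × TorusSite d L => μ) (torusHaar (TorusSite (d + 1) L)) :=
    measurePreserving_piCongrLeft (fun _ : TorusSite (d + 1) L => μ) σ
  have h2 : MeasurePreserving (MeasurableEquiv.curry (ZMod L) (TorusSite d L) Circle)
      (Measure.pi fun _ : ZMod L × TorusSite d L => μ) (Measure.pi fun _ : ZMod L => torusHaar (TorusSite d L)) := by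
    refine ⟨MeasurableEquiv.measurable _, ?_⟩
    have h := Measure.infinitePi_map_curry (fun (_ : ZMod L) (_ : TorusSite d L) => μ)
    simp only [Measure.infinitePi_eq_pi] at h
    exact h
  have hΦ : MeasurePreserving Φ (torusHaar (TorusSite (d + 1) L))
      (Measure.pi fun _ : ZMod L => torusHaar (TorusSite d L)) := h2.comp (h1.symm _)
  have hcoe : ∀ θ : TorusSite (d + 1) L → Circle, Φ θ = fun k y => θ (Fin.snoc y k) := fun θ => rfl
  rw [← hΦ.integral_comp']
  simp_rw [hcoe]

/-- **Gibbs expectations of layer-wise products factorise over the layers** (the decoupled stack is `L`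
independent copies of the `d`-dimensional model):
`⟨∏_k g_k(θ|_{layer k})⟩^{(d+1)}_{snoc K 0} = ∏_k ⟨g_k⟩^{(d)}_K`.
[cite: LiuStanley1972, p. 272 (ε = 0: independent layers); Ginibre1970, Example 4 (plane rotators)] -/
theorem torusXY_expectJ_stack_prod (K : Fin d → ℝ) (g : ZMod L → (TorusSite d L → Circle) → ℝ) :
    (torusXY (d + 1) L).expectJ (fun b => (Fin.snoc K 0 : Fin (d + 1) → ℝ) b.2)
        (fun θ => ∏ k, g k (fun y => θ (Fin.snoc y k))) =
      ∏ k, (torusXY d L).expectJ (fun b => K b.2) (g k) := by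
  simp only [BondSystem.expectJ_eq, BondSystem.partitionFnJ]
  rw [Finset.prod_div_distrib]
  congr 1
  · calc ∫ θ, (∏ k, g k (fun y => θ (Fin.snoc y k))) *
          (torusXY (d + 1) L).weightJ (fun b => (Fin.snoc K 0 : Fin (d + 1) → ℝ) b.2) θ
            ∂torusHaar (TorusSite (d + 1) L)
        = ∫ θ, (fun Θ : ZMod L → TorusSite d L → Circle =>
            ∏ k, (g k (Θ k) * (torusXY d L).weightJ (fun b => K b.2) (Θ k))) (fun k y => θ (Fin.snoc y k))
            ∂torusHaar (TorusSite (d + 1) L) := by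
          refine integral_congr_ae (ae_of_all _ fun θ => ?_)
          simp only [torusXY_weightJ_stack, Finset.prod_mul_distrib]
      _ = ∫ Θ, ∏ k, (g k (Θ k) * (torusXY d L).weightJ (fun b => K b.2) (Θ k))
            ∂(Measure.pi fun _ : ZMod L => torusHaar (TorusSite d L)) :=
          integral_torusHaar_stack (fun Θ : ZMod L → TorusSite d L → Circle =>
            ∏ k, (g k (Θ k) * (torusXY d L).weightJ (fun b => K b.2) (Θ k)))
      _ = ∏ k, ∫ η, g k η * (torusXY d L).weightJ (fun b => K b.2) η ∂torusHaar (TorusSite d L) :=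
          integral_fintype_prod_eq_prod
            (f := fun (k : ZMod L) (η : TorusSite d L → Circle) => g k η * (torusXY d L).weightJ (fun b => K b.2) η)
  · calc ∫ θ, (torusXY (d + 1) L).weightJ (fun b => (Fin.snoc K 0 : Fin (d + 1) → ℝ) b.2) θ
            ∂torusHaar (TorusSite (d + 1) L)
        = ∫ θ, (fun Θ : ZMod L → TorusSite d L → Circle =>
            ∏ k, (torusXY d L).weightJ (fun b => K b.2) (Θ k)) (fun k y => θ (Fin.snoc y k))
            ∂torusHaar (TorusSite (d + 1) L) := by
          refine integral_congr_ae (ae_of_all _ fun θ => ?_)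
          simp only [torusXY_weightJ_stack]
      _ = ∫ Θ, ∏ k, (torusXY d L).weightJ (fun b => K b.2) (Θ k)
            ∂(Measure.pi fun _ : ZMod L => torusHaar (TorusSite d L)) :=
          integral_torusHaar_stack (fun Θ : ZMod L → TorusSite d L → Circle =>
            ∏ k, (torusXY d L).weightJ (fun b => K b.2) (Θ k))
      _ = ∏ k, ∫ η, (torusXY d L).weightJ (fun b => K b.2) η ∂torusHaar (TorusSite d L) :=
          integral_fintype_prod_eq_prod
            (f := fun (_ : ZMod L) (η : TorusSite d L → Circle) => (torusXY d L).weightJ (fun b => K b.2) η)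

/-- `⟨c⟩_J = c` for any finite bond system (normalisation of the Gibbs state). [cite: Ginibre1970, Example 4 (plane rotators) — plumbing] -/
theorem BondSystem.expectJ_const {V ι : Type*} [Fintype V] [Fintype ι] (G : BondSystem V ι) (J : ι → ℝ) (c : ℝ) :
    G.expectJ J (fun _ => c) = c := by
  rw [G.expectJ_eq, integral_const_mul, show (∫ θ, G.weightJ J θ ∂torusHaar V) = G.partitionFnJ J from rfl,
    mul_div_assoc, div_self (G.partitionFnJ_pos J).ne', mul_one]

/-- **A one-layer observable has the layer's expectation**: `⟨f(θ|_{layer k})⟩^{(d+1)}_{snoc K 0} = ⟨f⟩^{(d)}_K`.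
[cite: LiuStanley1972, p. 272 (ε = 0: independent layers); Ginibre1970, Example 4 (plane rotators)] -/
theorem torusXY_expectJ_stack_layer (K : Fin d → ℝ) (k : ZMod L) (f : (TorusSite d L → Circle) → ℝ) :
    (torusXY (d + 1) L).expectJ (fun b => (Fin.snoc K 0 : Fin (d + 1) → ℝ) b.2)
        (fun θ => f (fun y => θ (Fin.snoc y k))) =
      (torusXY d L).expectJ (fun b => K b.2) f := by
  classical
  have h := torusXY_expectJ_stack_prod (L := L) K (fun k' => if k' = k then f else fun _ => 1)
  have hprod : ∀ θ : TorusSite (d + 1) L → Circle,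
      (∏ k', (if k' = k then f else fun _ => 1) (fun y => θ (Fin.snoc y k'))) = f (fun y => θ (Fin.snoc y k)) := by
    intro θ
    rw [Finset.prod_eq_single k (fun k' _ hk' => by rw [if_neg hk']) (fun hk => absurd (Finset.mem_univ k) hk),
      if_pos rfl]
  simp_rw [hprod] at h
  rw [h, Finset.prod_eq_single k (fun k' _ hk' => by rw [if_neg hk', BondSystem.expectJ_const])
    (fun hk => absurd (Finset.mem_univ k) hk), if_pos rfl]

/-- **Observables of two different layers are independent**: for `k ≠ k'`,
`⟨f(θ|_{layer k}) g(θ|_{layer k'})⟩^{(d+1)}_{snoc K 0} = ⟨f⟩^{(d)}_K ⟨g⟩^{(d)}_K`.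
[cite: LiuStanley1972, p. 272 (ε = 0: independent layers); Ginibre1970, Example 4 (plane rotators)] -/
theorem torusXY_expectJ_stack_layer_mul_layer (K : Fin d → ℝ) {k k' : ZMod L} (hkk' : k ≠ k')
    (f g : (TorusSite d L → Circle) → ℝ) :
    (torusXY (d + 1) L).expectJ (fun b => (Fin.snoc K 0 : Fin (d + 1) → ℝ) b.2)
        (fun θ => f (fun y => θ (Fin.snoc y k)) * g (fun y => θ (Fin.snoc y k'))) =
      (torusXY d L).expectJ (fun b => K b.2) f * (torusXY d L).expectJ (fun b => K b.2) g := by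
  classical
  let G : ZMod L → (TorusSite d L → Circle) → ℝ := fun k'' => if k'' = k then f else if k'' = k' then g else fun _ => 1
  have hGk : G k = f := by simp only [G, if_pos rfl]
  have hGk' : G k' = g := by simp [G, hkk'.symm]
  have hG1 : ∀ c, c ≠ k ∧ c ≠ k' → G c = fun _ => 1 := fun c hc => by simp only [G, if_neg hc.1, if_neg hc.2]
  have h := torusXY_expectJ_stack_prod (L := L) K G
  have hprod : ∀ θ : TorusSite (d + 1) L → Circle, (∏ c, G c (fun y => θ (Fin.snoc y c))) =
      f (fun y => θ (Fin.snoc y k)) * g (fun y => θ (Fin.snoc y k')) := by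
    intro θ
    rw [Finset.prod_eq_mul k k' hkk' (fun c _ hc => by rw [hG1 c hc]) (fun hk => absurd (Finset.mem_univ k) hk)
      (fun hk => absurd (Finset.mem_univ k') hk), hGk, hGk']
  simp_rw [hprod] at h
  rw [h, Finset.prod_eq_mul k k' hkk' (fun c _ hc => by rw [hG1 c hc, BondSystem.expectJ_const])
    (fun hk => absurd (Finset.mem_univ k) hk) (fun hk => absurd (Finset.mem_univ k') hk), hGk, hGk']

end Stack

/-! ## §2 The stack's in-layer helicity modulus is the layer's; no modulus across decoupled layers -/

section Modulus

/-- Profile bookkeeping: on an in-layer bond of the stack the `e_{castSucc i}`-slice profile is the layer's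
`e_i`-slice profile. [cite: FisherBarberJasnow1973, §II eqs. (2.3)–(2.5) (uniform twist)] -/
theorem axisProfile_castSucc_stack (i : Fin d) (p : ZMod L → ℝ) (k : ZMod L) (y : TorusSite d L) (m : Fin d) :
    axisProfile (Fin.castSucc i) p (Fin.snoc y k, Fin.castSucc m) = axisProfile i p (y, m) := by
  simp only [axisProfile, Fin.castSucc_inj, Fin.snoc_castSucc]

/-- An in-layer slice profile vanishes on the inter-layer bonds. [cite: FisherBarberJasnow1973, §II eqs. (2.3)–(2.5) (uniform twist)] -/
theorem axisProfile_castSucc_last (i : Fin d) (p : ZMod L → ℝ) (x : TorusSite (d + 1) L) :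
    axisProfile (Fin.castSucc i) p (x, Fin.last d) = 0 := by
  simp only [axisProfile, (Fin.castSucc_lt_last i).ne', if_false]

/-- The inter-layer slice profile vanishes on the in-layer bonds. [cite: FisherBarberJasnow1973, §II eqs. (2.3)–(2.5) (uniform twist)] -/
theorem axisProfile_last_castSucc (p : ZMod L → ℝ) (x : TorusSite (d + 1) L) (m : Fin d) :
    axisProfile (Fin.last d) p (x, Fin.castSucc m) = 0 := by
  simp only [axisProfile, (Fin.castSucc_lt_last m).ne, if_false]

/-- The layered couplings `(K∥, K∥, 0)` of `AnisotropicRotator.layeredCoupling` at zero interlayer coupling are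
`Fin.snoc (K∥, K∥) 0`. [cite: LiuStanley1972, p. 272 (layers (J, J, εJ), ε = 0)] -/
theorem layeredCoupling_zero_eq_snoc (Kp : ℝ) :
    AnisotropicRotator.layeredCoupling Kp 0 = (Fin.snoc (fun _ : Fin 2 => Kp) 0 : Fin 3 → ℝ) := by
  funext m
  fin_cases m <;> rfl

variable [NeZero L]

/-- **The twist current of an in-layer twist of the decoupled stack is the sum of the layer currents**:
`𝒥^{(d+1)}_{snoc K 0, e_{castSucc i}-slices p}(θ) = ∑_k 𝒥^{(d)}_{K, e_i-slices p}(θ|_{layer k})`.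
[cite: FisherBarberJasnow1973, §II eqs. (2.4)–(2.5) (twist current); LiuStanley1972, p. 272 (ε = 0)] -/
theorem torusXY_twistCurrent_stack (K : Fin d → ℝ) (i : Fin d) (p : ZMod L → ℝ) (θ : TorusSite (d + 1) L → Circle) :
    (torusXY (d + 1) L).twistCurrent (fun b => (Fin.snoc K 0 : Fin (d + 1) → ℝ) b.2) (axisProfile (Fin.castSucc i) p) θ =
      ∑ k : ZMod L, (torusXY d L).twistCurrent (fun b => K b.2) (axisProfile i p) (fun y => θ (Fin.snoc y k)) := by
  unfold BondSystem.twistCurrent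
  rw [sum_bonds_stack (fun b => (Fin.snoc K 0 : Fin (d + 1) → ℝ) b.2 * axisProfile (Fin.castSucc i) p b *
      imChar ((torusXY (d + 1) L).bondChar b) θ) (fun x => by simp only [Fin.snoc_last, zero_mul])]
  refine Finset.sum_congr rfl fun k _ => Finset.sum_congr rfl fun b _ => ?_
  obtain ⟨y, m⟩ := b
  simp only [Fin.snoc_castSucc, axisProfile_castSucc_stack, torusXY_imChar_bondChar_stack]

variable [MeasurableSpace Circle] [BorelSpace Circle]

/-- **The energy term of the stack's in-layer twist modulus is `L` times the layer's**:
`∑_a (snoc K 0)_a s_a² ⟨cos ∇θ_a⟩^{(d+1)} = L · ∑_{a'} K_{a'} s'_{a'}² ⟨cos ∇θ_{a'}⟩^{(d)}` (each in-layer bond energy of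
the decoupled stack is the layer's, `torusXY_expectJ_stack_layer`; there are `L` layers).
[cite: FisherBarberJasnow1973, §II eqs. (2.4)–(2.5) (helicity modulus, energy term); LiuStanley1972, p. 272 (ε = 0)] -/
theorem torusXY_twistEnergy_stack (K : Fin d → ℝ) (i : Fin d) (p : ZMod L → ℝ) :
    ∑ a, (Fin.snoc K 0 : Fin (d + 1) → ℝ) a.2 * axisProfile (Fin.castSucc i) p a ^ 2 *
        (torusXY (d + 1) L).expectJ (fun b => (Fin.snoc K 0 : Fin (d + 1) → ℝ) b.2)
          (reChar ((torusXY (d + 1) L).bondChar a)) =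
      L * ∑ a, K a.2 * axisProfile i p a ^ 2 * (torusXY d L).expectJ (fun b => K b.2) (reChar ((torusXY d L).bondChar a)) := by
  rw [sum_bonds_stack (fun a => (Fin.snoc K 0 : Fin (d + 1) → ℝ) a.2 * axisProfile (Fin.castSucc i) p a ^ 2 *
      (torusXY (d + 1) L).expectJ (fun b => (Fin.snoc K 0 : Fin (d + 1) → ℝ) b.2)
        (reChar ((torusXY (d + 1) L).bondChar a))) (fun x => by simp only [Fin.snoc_last, zero_mul])]
  have hk : ∀ k : ZMod L,
      ∑ b : TorusSite d L × Fin d, (Fin.snoc K 0 : Fin (d + 1) → ℝ) (Fin.castSucc b.2) *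
          axisProfile (Fin.castSucc i) p (Fin.snoc b.1 k, Fin.castSucc b.2) ^ 2 *
          (torusXY (d + 1) L).expectJ (fun b => (Fin.snoc K 0 : Fin (d + 1) → ℝ) b.2)
            (reChar ((torusXY (d + 1) L).bondChar (Fin.snoc b.1 k, Fin.castSucc b.2))) =
        ∑ a, K a.2 * axisProfile i p a ^ 2 * (torusXY d L).expectJ (fun b => K b.2) (reChar ((torusXY d L).bondChar a)) := by
    intro k
    refine Finset.sum_congr rfl fun b _ => ?_
    obtain ⟨y, m⟩ := b
    have hre : reChar ((torusXY (d + 1) L).bondChar (Fin.snoc y k, Fin.castSucc m)) =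
        fun θ => reChar ((torusXY d L).bondChar (y, m)) (fun y' => θ (Fin.snoc y' k)) :=
      funext fun θ => torusXY_reChar_bondChar_stack θ k y m
    simp only [Fin.snoc_castSucc, axisProfile_castSucc_stack]
    rw [hre, torusXY_expectJ_stack_layer]
  simp only [hk, Finset.sum_const, Finset.card_univ, ZMod.card, nsmul_eq_mul]

/-- **The current fluctuation of the stack's in-layer twist is `L` times the layer's**:
`⟨(𝒥^{(d+1)})²⟩^{(d+1)} = ∑_{k,k'} ⟨𝒥_k 𝒥_{k'}⟩ = L · ⟨(𝒥^{(d)})²⟩^{(d)}` — the layer currents are independent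
(`torusXY_expectJ_stack_layer_mul_layer`) with mean zero (`expectJ_twistCurrent_eq_zero`), so the cross-layer
covariances vanish. [cite: FisherBarberJasnow1973, §II eqs. (2.4)–(2.5) (helicity modulus, fluctuation term); LiuStanley1972, p. 272 (ε = 0)] -/
theorem torusXY_expectJ_twistCurrent_sq_stack (K : Fin d → ℝ) (i : Fin d) (p : ZMod L → ℝ) :
    (torusXY (d + 1) L).expectJ (fun b => (Fin.snoc K 0 : Fin (d + 1) → ℝ) b.2)
        (fun θ => (torusXY (d + 1) L).twistCurrent (fun b => (Fin.snoc K 0 : Fin (d + 1) → ℝ) b.2)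
          (axisProfile (Fin.castSucc i) p) θ ^ 2) =
      L * (torusXY d L).expectJ (fun b => K b.2)
        (fun η => (torusXY d L).twistCurrent (fun b => K b.2) (axisProfile i p) η ^ 2) := by
  have hlayer : ∀ k : ZMod L,
      Continuous fun θ : TorusSite (d + 1) L → Circle => fun y : TorusSite d L => θ (Fin.snoc y k) :=
    fun k => continuous_pi fun y => continuous_apply _
  have hjc : Continuous ((torusXY d L).twistCurrent (fun b => K b.2) (axisProfile i p)) :=
    (torusXY d L).continuous_twistCurrent _ _
  have hcur : ∀ θ : TorusSite (d + 1) L → Circle,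
      (torusXY (d + 1) L).twistCurrent (fun b => (Fin.snoc K 0 : Fin (d + 1) → ℝ) b.2)
          (axisProfile (Fin.castSucc i) p) θ ^ 2 =
        ∑ k : ZMod L, ∑ k' : ZMod L,
          (torusXY d L).twistCurrent (fun b => K b.2) (axisProfile i p) (fun y => θ (Fin.snoc y k)) *
            (torusXY d L).twistCurrent (fun b => K b.2) (axisProfile i p) (fun y => θ (Fin.snoc y k')) := fun θ => by
    rw [torusXY_twistCurrent_stack, sq, Finset.sum_mul_sum]
  simp_rw [hcur]
  rw [(torusXY (d + 1) L).expectJ_finset_sum _ Finset.univ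
    (f := fun k θ => ∑ k' : ZMod L,
      (torusXY d L).twistCurrent (fun b => K b.2) (axisProfile i p) (fun y => θ (Fin.snoc y k)) *
        (torusXY d L).twistCurrent (fun b => K b.2) (axisProfile i p) (fun y => θ (Fin.snoc y k')))
    (fun k => continuous_finsetSum _ fun k' _ => (hjc.comp (hlayer k)).mul (hjc.comp (hlayer k')))]
  have hinner : ∀ k : ZMod L,
      (torusXY (d + 1) L).expectJ (fun b => (Fin.snoc K 0 : Fin (d + 1) → ℝ) b.2)
          (fun θ => ∑ k' : ZMod L,
            (torusXY d L).twistCurrent (fun b => K b.2) (axisProfile i p) (fun y => θ (Fin.snoc y k)) *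
              (torusXY d L).twistCurrent (fun b => K b.2) (axisProfile i p) (fun y => θ (Fin.snoc y k'))) =
        (torusXY d L).expectJ (fun b => K b.2)
          (fun η => (torusXY d L).twistCurrent (fun b => K b.2) (axisProfile i p) η ^ 2) := by
    intro k
    rw [(torusXY (d + 1) L).expectJ_finset_sum _ Finset.univ
      (f := fun k' θ =>
        (torusXY d L).twistCurrent (fun b => K b.2) (axisProfile i p) (fun y => θ (Fin.snoc y k)) *
          (torusXY d L).twistCurrent (fun b => K b.2) (axisProfile i p) (fun y => θ (Fin.snoc y k')))
      (fun k' => (hjc.comp (hlayer k)).mul (hjc.comp (hlayer k'))),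
      Finset.sum_eq_single k (fun k' _ hk' => ?_) (fun hk => absurd (Finset.mem_univ k) hk)]
    · refine Eq.trans ?_ (torusXY_expectJ_stack_layer (L := L) K k
        (fun η => (torusXY d L).twistCurrent (fun b => K b.2) (axisProfile i p) η ^ 2))
      congr 1
      funext θ
      exact (sq _).symm
    · rw [torusXY_expectJ_stack_layer_mul_layer K (Ne.symm hk'), (torusXY d L).expectJ_twistCurrent_eq_zero,
        mul_zero]
  simp only [hinner, Finset.sum_const, Finset.card_univ, ZMod.card, nsmul_eq_mul]

/-- **The in-layer twist modulus of the decoupled stack is `L` times the layer's twist modulus**: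
`Q^{(d+1)}_{snoc K 0}(uniform e_{castSucc i}) = L · Q^{(d)}_K(uniform e_i)` (energy term `torusXY_twistEnergy_stack`,
fluctuation `torusXY_expectJ_twistCurrent_sq_stack`, mean current zero).
[cite: FisherBarberJasnow1973, §II eqs. (2.4)–(2.5) (helicity modulus); LiuStanley1972, p. 272 (ε = 0: independent layers)] -/
theorem torusXY_twistModulus_stack (K : Fin d → ℝ) (i : Fin d) :
    (torusXY (d + 1) L).twistModulus (fun b => (Fin.snoc K 0 : Fin (d + 1) → ℝ) b.2)
        (axisProfile (Fin.castSucc i) (1 : ZMod L → ℝ)) =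
      L * (torusXY d L).twistModulus (fun b => K b.2) (axisProfile i (1 : ZMod L → ℝ)) := by
  unfold BondSystem.twistModulus
  rw [torusXY_twistEnergy_stack, torusXY_expectJ_twistCurrent_sq_stack,
    (torusXY (d + 1) L).expectJ_twistCurrent_eq_zero, (torusXY d L).expectJ_twistCurrent_eq_zero]
  ring

/-- **The stack's in-layer helicity modulus is the layer's, at every size**: for the couplings `Fin.snoc K 0`
(no inter-layer coupling), `βΥ^{(d+1)}_{L, e_{castSucc i}}(snoc K 0) = βΥ^{(d)}_{L, e_i}(K)` — `L` independent layers
carry `L` times the twist free energy of one layer, spread over `L` times as many sites.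
[cite: FisherBarberJasnow1973, §II eqs. (2.4)–(2.5) (helicity modulus per site); LiuStanley1972, p. 272 (ε = 0: independent layers)] -/
theorem torusXYDirStiffness_stack_castSucc (K : Fin d → ℝ) (i : Fin d) :
    torusXYDirStiffness L (Fin.snoc K 0 : Fin (d + 1) → ℝ) (Fin.castSucc i) = torusXYDirStiffness L K i := by
  unfold torusXYDirStiffness
  rw [torusXY_twistModulus_stack, pow_succ, mul_comm (L : ℝ), mul_div_mul_right _ _ (Nat.cast_ne_zero.2 (NeZero.ne L))]

/-- **No helicity modulus across decoupled layers**: `βΥ^{(d+1)}_{L, e_{last}}(snoc K 0) = 0` — the inter-layer twist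
meets no coupling (energy term and twist current vanish identically).
[cite: FisherBarberJasnow1973, §II eqs. (2.4)–(2.5) (helicity modulus); LiuStanley1972, p. 272 (ε = 0)] -/
theorem torusXYDirStiffness_stack_last (K : Fin d → ℝ) :
    torusXYDirStiffness L (Fin.snoc K 0 : Fin (d + 1) → ℝ) (Fin.last d) = 0 := by
  have hJs : ∀ a : TorusSite (d + 1) L × Fin (d + 1),
      (Fin.snoc K 0 : Fin (d + 1) → ℝ) a.2 * axisProfile (Fin.last d) (1 : ZMod L → ℝ) a = 0 := by
    rintro ⟨x, n⟩
    refine Fin.lastCases ?_ (fun m => ?_) n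
    · simp only [Fin.snoc_last, zero_mul]
    · rw [axisProfile_last_castSucc, mul_zero]
  have hcur : (torusXY (d + 1) L).twistCurrent (fun b => (Fin.snoc K 0 : Fin (d + 1) → ℝ) b.2)
      (axisProfile (Fin.last d) (1 : ZMod L → ℝ)) = fun _ => 0 := by
    funext θ
    unfold BondSystem.twistCurrent
    exact Finset.sum_eq_zero fun a _ => by rw [hJs a, zero_mul]
  unfold torusXYDirStiffness BondSystem.twistModulus
  rw [hcur, Finset.sum_eq_zero fun a _ => by rw [sq, ← mul_assoc, hJs a, zero_mul, zero_mul]]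
  simp [BondSystem.expectJ_const]

/-- **`βΥ^{3D}_{L,e₁}(K∥, K∥, 0) = βΥ^{2D}_L(K∥)` at every `L`**: the in-plane stack stiffness of `L` DECOUPLED XY layers on
`(ℤ/Lℤ)³` is the helicity modulus `torusXYStiffness L K∥` of one layer on `(ℤ/Lℤ)²` (the `J⊥ = 0` point of the
2D → 3D comparison, exact at finite volume). [cite: FisherBarberJasnow1973, §II eqs. (2.4)–(2.5) (helicity modulus); LiuStanley1972, p. 272 (ε = 0: independent layers)] -/
theorem torusXYDirStiffness_layered_zero_eq_torusXYStiffness (Kp : ℝ) :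
    torusXYDirStiffness L (AnisotropicRotator.layeredCoupling Kp 0) 0 = torusXYStiffness L Kp := by
  rw [layeredCoupling_zero_eq_snoc, show (0 : Fin 3) = Fin.castSucc (0 : Fin 2) from rfl,
    torusXYDirStiffness_stack_castSucc, torusXYDirStiffness_two]

/-- The second in-plane direction: `βΥ^{3D}_{L,e₂}(K∥, K∥, 0) = βΥ^{2D}_{L,e₂}(K∥)` (the layer's modulus along `e₂`).
[cite: FisherBarberJasnow1973, §II eqs. (2.4)–(2.5); LiuStanley1972, p. 272 (ε = 0)] -/
theorem torusXYDirStiffness_layered_zero_one (Kp : ℝ) :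
    torusXYDirStiffness L (AnisotropicRotator.layeredCoupling Kp 0) 1 = torusXYDirStiffness L (fun _ : Fin 2 => Kp) 1 := by
  rw [layeredCoupling_zero_eq_snoc, show (1 : Fin 3) = Fin.castSucc (1 : Fin 2) from rfl,
    torusXYDirStiffness_stack_castSucc]

/-- **No c-axis stiffness without interlayer coupling**: `βΥ^{3D}_{L,e₃}(K∥, K∥, 0) = 0` at every `L`.
[cite: FisherBarberJasnow1973, §II eqs. (2.4)–(2.5); LiuStanley1972, p. 272 (ε = 0)] -/
theorem torusXYDirStiffness_layered_zero_two (Kp : ℝ) :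
    torusXYDirStiffness L (AnisotropicRotator.layeredCoupling Kp 0) 2 = 0 := by
  rw [layeredCoupling_zero_eq_snoc, show (2 : Fin 3) = Fin.last 2 from rfl, torusXYDirStiffness_stack_last]

end Modulus

/-! ## §3 The infinite-volume stack stiffness `Υ^{3D}_∞(K∥, K⊥, i)` -/

namespace AnisotropicRotator

/- As in §5 of `LayeredPlaneRotatorStackStiffness.lean`: the floor files fix the Borel structure of `Circle` as a
global instance; the instance-generic theorems of §1–§2 are used at that instance below. -/

/-- **The infinite-volume (lower-envelope) stack stiffness of the layered plane rotator**,
`Υ^{3D}_∞(K∥, K⊥, i) := liminf_{L → ∞} βΥ^{3D}_{L+1, eᵢ}(K∥, K∥, K⊥)` — the `liminf` of the reduced directional helicity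
modulus `torusXYDirStiffness (L+1) (layeredCoupling K∥ K⊥) i` of the stack on `(ℤ/(L+1)ℤ)³` (in-plane `i = 0, 1`,
c-axis `i = 2`); the twin of the single layer's `torusXYStiffnessLiminf`. The thermodynamic helicity modulus of
Fisher–Barber–Jasnow is the limit when it exists, and the `liminf` coincides with it then.
[cite: FisherBarberJasnow1973, §II eq. (2.5) (thermodynamic helicity modulus); LiuStanley1972, p. 272 (layers (J, J, εJ))] -/
def layeredStiffnessLiminf (Kp Kz : ℝ) (i : Fin 3) : ℝ :=
  Filter.liminf (fun L : ℕ => torusXYDirStiffness (L + 1) (layeredCoupling Kp Kz) i) atTop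

section Bounds

variable {Kp Kz : ℝ}

/-- The sequence `βΥ^{3D}_{L+1,i}` is bounded below by `0` (`K∥, K⊥ ≥ 0`). [cite: FisherBarberJasnow1973, §II eqs. (2.4)–(2.5); Ginibre1970 §2 Examples 2 and 4] -/
private theorem isBoundedUnder_ge_dirStiffness (hp : 0 ≤ Kp) (hz : 0 ≤ Kz) (i : Fin 3) :
    IsBoundedUnder (· ≥ ·) atTop (fun L : ℕ => torusXYDirStiffness (L + 1) (layeredCoupling Kp Kz) i) :=
  isBoundedUnder_of ⟨0, fun _ => torusXYDirStiffness_nonneg (layeredCoupling_nonneg hp hz) i⟩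

/-- The sequence `βΥ^{3D}_{L+1,i}` is bounded above by `K_i` (`K∥, K⊥ ≥ 0`). [cite: FisherBarberJasnow1973, §II eqs. (2.4)–(2.5)] -/
private theorem isBoundedUnder_le_dirStiffness (hp : 0 ≤ Kp) (hz : 0 ≤ Kz) (i : Fin 3) :
    IsBoundedUnder (· ≤ ·) atTop (fun L : ℕ => torusXYDirStiffness (L + 1) (layeredCoupling Kp Kz) i) :=
  isBoundedUnder_of ⟨layeredCoupling Kp Kz i, fun _ => torusXYDirStiffness_le_coupling (layeredCoupling_nonneg hp hz) i⟩

/-- **If the thermodynamic limit exists it is `Υ^{3D}_∞`**: `βΥ^{3D}_{L+1,i} → y ⇒ Υ^{3D}_∞(K∥, K⊥, i) = y`.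
[cite: FisherBarberJasnow1973, §II eq. (2.5) (thermodynamic helicity modulus)] -/
theorem layeredStiffnessLiminf_eq_of_tendsto {y : ℝ} {i : Fin 3}
    (h : Tendsto (fun L : ℕ => torusXYDirStiffness (L + 1) (layeredCoupling Kp Kz) i) atTop (𝓝 y)) :
    layeredStiffnessLiminf Kp Kz i = y :=
  h.liminf_eq

/-- **`0 ≤ Υ^{3D}_∞`** for `K∥, K⊥ ≥ 0` (Ginibre's twist inequality at every finite volume).
[cite: FisherBarberJasnow1973, §II eqs. (2.4)–(2.5); Ginibre1970 §2 Examples 2 and 4] -/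
theorem layeredStiffnessLiminf_nonneg (hp : 0 ≤ Kp) (hz : 0 ≤ Kz) (i : Fin 3) : 0 ≤ layeredStiffnessLiminf Kp Kz i :=
  le_liminf_of_le (isBoundedUnder_le_dirStiffness hp hz i).isCoboundedUnder_ge
    (Eventually.of_forall fun _ => torusXYDirStiffness_nonneg (layeredCoupling_nonneg hp hz) i)

/-- An eventual finite-volume ceiling is a ceiling for `Υ^{3D}_∞` (`K∥, K⊥ ≥ 0`). [cite: FisherBarberJasnow1973, §II eq. (2.5)] -/
theorem layeredStiffnessLiminf_le_of_eventually_le (hp : 0 ≤ Kp) (hz : 0 ≤ Kz) {i : Fin 3} {c : ℝ}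
    (h : ∀ᶠ L : ℕ in atTop, torusXYDirStiffness (L + 1) (layeredCoupling Kp Kz) i ≤ c) :
    layeredStiffnessLiminf Kp Kz i ≤ c :=
  liminf_le_of_frequently_le h.frequently (isBoundedUnder_ge_dirStiffness hp hz i)

/-- **`Υ^{3D}_∞(K∥, K⊥, i) ≤ K_i`** — the bare f-sum bound `βΥ_{L,i} ≤ K_i` (`torusXYDirStiffness_le_coupling`) in the
limit: in-plane `≤ K∥`, c-axis `≤ K⊥`. [cite: FisherBarberJasnow1973, §II eqs. (2.4)–(2.5) (f-sum bound)] -/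
theorem layeredStiffnessLiminf_le_coupling (hp : 0 ≤ Kp) (hz : 0 ≤ Kz) (i : Fin 3) :
    layeredStiffnessLiminf Kp Kz i ≤ layeredCoupling Kp Kz i :=
  layeredStiffnessLiminf_le_of_eventually_le hp hz
    (Eventually.of_forall fun _ => torusXYDirStiffness_le_coupling (layeredCoupling_nonneg hp hz) i)

/-- **The in-plane stack stiffness is at most the in-plane coupling**: `Υ^{3D}_∞(K∥, K⊥, e₁) ≤ K∥`.
[cite: FisherBarberJasnow1973, §II eqs. (2.4)–(2.5) (f-sum bound)] -/
theorem layeredStiffnessLiminf_inPlane_le (hp : 0 ≤ Kp) (hz : 0 ≤ Kz) : layeredStiffnessLiminf Kp Kz 0 ≤ Kp := by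
  have h := layeredStiffnessLiminf_le_coupling hp hz 0
  rwa [show layeredCoupling Kp Kz 0 = Kp by simp [layeredCoupling]] at h

/-- **The c-axis stack stiffness is at most the interlayer coupling**: `Υ^{3D}_∞(K∥, K⊥, e₃) ≤ K⊥` (so it vanishes
linearly in the weak-interlayer limit, whatever the in-plane state). [cite: FisherBarberJasnow1973, §II eqs. (2.4)–(2.5) (f-sum bound); LiuStanley1972, p. 272] -/
theorem layeredStiffnessLiminf_cAxis_le (hp : 0 ≤ Kp) (hz : 0 ≤ Kz) : layeredStiffnessLiminf Kp Kz 2 ≤ Kz := by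
  have h := layeredStiffnessLiminf_le_coupling hp hz 2
  rwa [show layeredCoupling Kp Kz 2 = Kz by simp [layeredCoupling]] at h

/-- `Υ^{3D}_∞ ∈ [0, K_i]`. [cite: FisherBarberJasnow1973, §II eqs. (2.4)–(2.5)] -/
theorem layeredStiffnessLiminf_mem_Icc (hp : 0 ≤ Kp) (hz : 0 ≤ Kz) (i : Fin 3) :
    layeredStiffnessLiminf Kp Kz i ∈ Set.Icc 0 (layeredCoupling Kp Kz i) :=
  ⟨layeredStiffnessLiminf_nonneg hp hz i, layeredStiffnessLiminf_le_coupling hp hz i⟩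

end Bounds

/-! ### The decoupled point `K⊥ = 0`: `Υ^{3D}_∞(K, 0, e₁) = Υ_∞(K)`, `Υ^{3D}_∞(K, 0, e₃) = 0` -/

/-- **At zero interlayer coupling the in-plane stack stiffness IS the single layer's**:
`Υ^{3D}_∞(K, 0, e₁) = Υ_∞(K) = torusXYStiffnessLiminf K` (from the finite-volume identity
`torusXYDirStiffness_layered_zero_eq_torusXYStiffness` at every `L`). [cite: FisherBarberJasnow1973, §II eq. (2.5); LiuStanley1972, p. 272 (ε = 0: independent layers)] -/
theorem layeredStiffnessLiminf_zero_inPlane (K : ℝ) : layeredStiffnessLiminf K 0 0 = torusXYStiffnessLiminf K := by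
  unfold layeredStiffnessLiminf torusXYStiffnessLiminf
  simp only [torusXYDirStiffness_layered_zero_eq_torusXYStiffness]

/-- **At zero interlayer coupling there is no c-axis stiffness**: `Υ^{3D}_∞(K, 0, e₃) = 0`.
[cite: FisherBarberJasnow1973, §II eq. (2.5); LiuStanley1972, p. 272 (ε = 0)] -/
theorem layeredStiffnessLiminf_zero_cAxis (K : ℝ) : layeredStiffnessLiminf K 0 2 = 0 := by
  unfold layeredStiffnessLiminf
  simp only [torusXYDirStiffness_layered_zero_two, liminf_const]

/-! ### (β) `Υ^{3D}_∞ = 0` wherever the stack's high-temperature phase is certified -/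

section Zero

/-- `βΥ^{3D}_{L+1,i} → 0 ⇒ Υ^{3D}_∞ = 0`. [cite: FisherBarberJasnow1973, §II eq. (2.5)] -/
theorem layeredStiffnessLiminf_eq_zero_of_tendsto {Kp Kz : ℝ} {i : Fin 3}
    (h : Tendsto (fun L : ℕ => torusXYDirStiffness (L + 1) (layeredCoupling Kp Kz) i) atTop (𝓝 0)) :
    layeredStiffnessLiminf Kp Kz i = 0 :=
  h.liminf_eq

/-- **ONE terminating cube kills `Υ^{3D}_∞`**: for `β, J∥, J⊥ ≥ 0` and one `R ≥ 1` with cube number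
`S_{(R,R,R)}(β; J∥, J⊥) < 1`, `Υ^{3D}_∞(βJ∥, βJ⊥, i) = 0` in every direction
(`tendsto_torusXYDirStiffness_layered_of_cube_lt_one`). [cite: Lieb1980, Theorem 4 and p. 128 (boxes: the finite algorithm); FisherBarberJasnow1973 §II] -/
theorem layeredStiffnessLiminf_eq_zero_of_cube_lt_one {β Jp Jz : ℝ} (hβ : 0 ≤ β) (hp : 0 ≤ Jp) (hz : 0 ≤ Jz)
    {R : ℕ} (hR : 1 ≤ R)
    (hS : aboxShellSum (fun u v : Site 3 => β / 2 * LongRangeIsing.layeredCoupling Jp Jz u v) (fun _ : Fin 3 => R) < 1)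
    (i : Fin 3) : layeredStiffnessLiminf (β * Jp) (β * Jz) i = 0 :=
  layeredStiffnessLiminf_eq_zero_of_tendsto (tendsto_torusXYDirStiffness_layered_of_cube_lt_one hβ hp hz hR hS i)

/-- **A finite free susceptibility kills `Υ^{3D}_∞`**: `∑_z G^{3D,free,∞}_{β;J∥,J⊥}(0, z) < ∞ ⇒ Υ^{3D}_∞(βJ∥, βJ⊥, i) = 0`
in every direction (Simon–Lieb, `tendsto_torusXYDirStiffness_layered_of_summable`). [cite: Simon1980CMP, Thm 1.3; Lieb1980, Theorem 4 and p. 128; FisherBarberJasnow1973 §II] -/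
theorem layeredStiffnessLiminf_eq_zero_of_summable {β Jp Jz : ℝ} (hβ : 0 ≤ β) (hp : 0 ≤ Jp) (hz : 0 ≤ Jz)
    (hG : Summable fun z : Site 3 => infTwoPointLayered β Jp Jz 0 z) (i : Fin 3) :
    layeredStiffnessLiminf (β * Jp) (β * Jz) i = 0 :=
  layeredStiffnessLiminf_eq_zero_of_tendsto (tendsto_torusXYDirStiffness_layered_of_summable hβ hp hz hG i)

/-- Reduced-coupling form: `∑_z G^{3D}_{(K∥, K⊥)}(0, z) < ∞ ⇒ Υ^{3D}_∞(K∥, K⊥, i) = 0` (`K∥, K⊥ ≥ 0`;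
`G^{3D}_{(K∥,K⊥)} = infTwoPointLayered 1 K∥ K⊥`). [cite: Simon1980CMP, Thm 1.3; Lieb1980, Theorem 4 and p. 128; FisherBarberJasnow1973 §II] -/
theorem layeredStiffnessLiminf_eq_zero_of_summable' {Kp Kz : ℝ} (hp : 0 ≤ Kp) (hz : 0 ≤ Kz)
    (hG : Summable fun z : Site 3 => infTwoPointLayered 1 Kp Kz 0 z) (i : Fin 3) :
    layeredStiffnessLiminf Kp Kz i = 0 := by
  have h := layeredStiffnessLiminf_eq_zero_of_summable zero_le_one hp hz hG i
  rwa [one_mul, one_mul] at h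

/-- **A bounded periodic susceptibility kills `Υ^{3D}_∞`** (`T_Υ^{3D} ≤ T_χ^{3D}` on the periodic objects,
`tendsto_torusXYDirStiffness_layered_of_torus_susceptibility_bounded`). [cite: Simon1980CMP, Thm 1.3; Lieb1980, Theorem 4 and p. 128; FisherBarberJasnow1973 §II] -/
theorem layeredStiffnessLiminf_eq_zero_of_torus_susceptibility_bounded {β Jp Jz : ℝ} (hβ : 0 ≤ β) (hp : 0 ≤ Jp)
    (hz : 0 ≤ Jz)
    (hχ : ∃ (B : ℝ) (L₀ : ℕ), ∀ (L : ℕ) [NeZero L], L₀ ≤ L →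
      ∑ y : TorusSite 3 L, corr (layeredCoupling (β * Jp) (β * Jz)) 0 y ≤ B) (i : Fin 3) :
    layeredStiffnessLiminf (β * Jp) (β * Jz) i = 0 :=
  layeredStiffnessLiminf_eq_zero_of_tendsto
    (tendsto_torusXYDirStiffness_layered_of_torus_susceptibility_bounded hβ hp hz hχ i)

/-- **`Υ^{3D}_∞ = 0` on Lieb's star region**: `β, J∥, J⊥ ≥ 0`, `βJ∥ ≤ x`, `βJ⊥ ≤ y`,
`4x/√(x²+4) + 2y/√(y²+4) < 1 ⇒ Υ^{3D}_∞(βJ∥, βJ⊥, i) = 0` in every direction. [cite: Lieb1980, Theorem 4 (star criterion); Amos1974 (Bessel ratio bound, via the tree); FisherBarberJasnow1973 §II] -/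
theorem layeredStiffnessLiminf_eq_zero_of_amos_star_lt_one {β Jp Jz x y : ℝ} (hβ : 0 ≤ β) (hp : 0 ≤ Jp)
    (hz : 0 ≤ Jz) (hx : β * Jp ≤ x) (hy : β * Jz ≤ y)
    (hm : 4 * (x / Real.sqrt (x ^ 2 + 4)) + 2 * (y / Real.sqrt (y ^ 2 + 4)) < 1) (i : Fin 3) :
    layeredStiffnessLiminf (β * Jp) (β * Jz) i = 0 :=
  layeredStiffnessLiminf_eq_zero_of_tendsto (tendsto_torusXYDirStiffness_layered_of_amos_star_lt_one hβ hp hz hx hy hm i)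

/-- Temperature form of the star region: `J∥, J⊥ ≥ 0`, `T > 0`, `4J∥/√(J∥² + 4T²) + 2J⊥/√(J⊥² + 4T²) < 1 ⇒
Υ^{3D}_∞(J∥/T, J⊥/T, i) = 0`. [cite: Lieb1980, Theorem 4 (star criterion); FisherBarberJasnow1973 §II] -/
theorem layeredStiffnessLiminf_eq_zero_of_amos_star_temperature {Jp Jz T : ℝ} (hp : 0 ≤ Jp) (hz : 0 ≤ Jz)
    (hT : 0 < T) (hm : 4 * (Jp / Real.sqrt (Jp ^ 2 + 4 * T ^ 2)) + 2 * (Jz / Real.sqrt (Jz ^ 2 + 4 * T ^ 2)) < 1)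
    (i : Fin 3) : layeredStiffnessLiminf (T⁻¹ * Jp) (T⁻¹ * Jz) i = 0 :=
  layeredStiffnessLiminf_eq_zero_of_tendsto (tendsto_torusXYDirStiffness_layered_of_amos_star_temperature hp hz hT hm i)

/-- **The weak-interlayer window at every in-plane coupling with a finite layer susceptibility**: if
`∑_x G^{2D}_{K₀}(0, x) < ∞` (`K₀ ≥ 0`) then for some `δ > 0`: `βJ∥ ≤ K₀`, `βJ⊥ ≤ δ ⇒ Υ^{3D}_∞(βJ∥, βJ⊥, i) = 0` in
every direction — `limsup_{J⊥ → 0} T_Υ^{3D}(J∥, J⊥) ≤ T_χ^{2D}(J∥)`. [cite: LiuStanley1972, p. 272 (weak interlayer coupling); Simon1980CMP Thm 1.3; Lieb1980 Theorem 4 and p. 128] -/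
theorem exists_interlayer_window_layeredStiffnessLiminf_eq_zero_of_summable_layer {K₀ : ℝ} (hK0 : 0 ≤ K₀)
    (hG : Summable fun x : Site 2 => infTwoPoint K₀ 2 0 x) :
    ∃ δ : ℝ, 0 < δ ∧ ∀ ⦃β Jp Jz : ℝ⦄, 0 ≤ β → 0 ≤ Jp → 0 ≤ Jz → β * Jp ≤ K₀ → β * Jz ≤ δ → ∀ i : Fin 3,
      layeredStiffnessLiminf (β * Jp) (β * Jz) i = 0 := by
  obtain ⟨δ, hδ, h⟩ := exists_interlayer_window_tendsto_torusXYDirStiffness_of_summable_layer hK0 hG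
  exact ⟨δ, hδ, fun β Jp Jz hβ hp hz hx hy i => layeredStiffnessLiminf_eq_zero_of_tendsto (h hβ hp hz hx hy i)⟩

/-- **The Onsager–Aizenman–Simon window**: every `K₀ < log(1 + √2)` has a `δ > 0` with `βJ∥ ≤ K₀`, `βJ⊥ ≤ δ ⇒
Υ^{3D}_∞(βJ∥, βJ⊥, i) = 0`. [cite: AizenmanSimon1980RotorIsing, eqs. (1)–(2) (the layer input, via the tree); LiuStanley1972 p. 272] -/
theorem exists_interlayer_window_layeredStiffnessLiminf_eq_zero_of_lt_log_one_add_sqrt_two {K₀ : ℝ} (hK0 : 0 ≤ K₀)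
    (hK : K₀ < Real.log (1 + Real.sqrt 2)) :
    ∃ δ : ℝ, 0 < δ ∧ ∀ ⦃β Jp Jz : ℝ⦄, 0 ≤ β → 0 ≤ Jp → 0 ≤ Jz → β * Jp ≤ K₀ → β * Jz ≤ δ → ∀ i : Fin 3,
      layeredStiffnessLiminf (β * Jp) (β * Jz) i = 0 := by
  obtain ⟨δ, hδ, h⟩ := exists_interlayer_window_tendsto_torusXYDirStiffness_of_lt_log_one_add_sqrt_two hK0 hK
  exact ⟨δ, hδ, fun β Jp Jz hβ hp hz hx hy i => layeredStiffnessLiminf_eq_zero_of_tendsto (h hβ hp hz hx hy i)⟩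

/-- **The explicit window from ONE two-dimensional box**: `S_R(K₀) < 1` (`R ≥ 1`, `K₀ ≥ 0`), `βJ∥ ≤ K₀`,
`βJ⊥ ≤ (1 − S_R(K₀))/(2(χ^{int}_R(K₀) + 1)) ⇒ Υ^{3D}_∞(βJ∥, βJ⊥, i) = 0`. [cite: Lieb1980, Theorem 4 and p. 128 (boxes; finite algorithm); LiuStanley1972 p. 272] -/
theorem layeredStiffnessLiminf_eq_zero_of_nnBoxShellSum_lt_one {K₀ : ℝ} (hK0 : 0 ≤ K₀) {R : ℕ} (hR : 1 ≤ R)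
    (hS : nnBoxShellSum K₀ 2 R < 1) {β Jp Jz : ℝ} (hβ : 0 ≤ β) (hp : 0 ≤ Jp) (hz : 0 ≤ Jz) (hx : β * Jp ≤ K₀)
    (hy : β * Jz ≤ (1 - nnBoxShellSum K₀ 2 R) / (2 * (boxInteriorSum K₀ R + 1))) (i : Fin 3) :
    layeredStiffnessLiminf (β * Jp) (β * Jz) i = 0 :=
  layeredStiffnessLiminf_eq_zero_of_tendsto
    (tendsto_torusXYDirStiffness_layered_of_nnBoxShellSum_lt_one hK0 hR hS hβ hp hz hx hy i)

end Zero

/-! ### (γ) Where `Υ^{3D}_∞ > 0` the stack susceptibility is infinite: `T_Υ^{3D} ≤ T_χ^{3D}` -/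

section Positive

variable {Kp Kz : ℝ}

/-- `Υ^{3D}_∞ > 0 ⇒ βΥ^{3D}_{L+1,i} ↛ 0`. [cite: FisherBarberJasnow1973, §II eq. (2.5)] -/
theorem not_tendsto_torusXYDirStiffness_of_layeredStiffnessLiminf_pos {i : Fin 3} (h : 0 < layeredStiffnessLiminf Kp Kz i) :
    ¬ Tendsto (fun L : ℕ => torusXYDirStiffness (L + 1) (layeredCoupling Kp Kz) i) atTop (𝓝 0) :=
  fun ht => h.ne' (layeredStiffnessLiminf_eq_zero_of_tendsto ht)

/-- **`Υ^{3D}_∞(K∥, K⊥, i) > 0 ⇒ χ^{3D,free}(K∥, K⊥) = ∞`**: the stack's infinite-volume free two-point function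
`G^{3D}_{(K∥,K⊥)}(0, ·)` is not summable — the stiffness onset of the stack lies at or below its susceptibility
transition, `T_Υ^{3D}(J∥, J⊥) ≤ T_χ^{3D}(J∥, J⊥)` (Simon–Lieb, `not_summable_layered_of_not_tendsto_torusXYDirStiffness`).
[cite: Simon1980CMP, Thm 1.3; Lieb1980, Theorem 4 and p. 128; FisherBarberJasnow1973 §II] -/
theorem not_summable_layered_of_layeredStiffnessLiminf_pos (hp : 0 ≤ Kp) (hz : 0 ≤ Kz) {i : Fin 3}
    (h : 0 < layeredStiffnessLiminf Kp Kz i) : ¬ Summable fun z : Site 3 => infTwoPointLayered 1 Kp Kz 0 z :=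
  fun hG => not_tendsto_torusXYDirStiffness_of_layeredStiffnessLiminf_pos h
    (by simpa only [one_mul] using tendsto_torusXYDirStiffness_layered_of_summable zero_le_one hp hz hG i)

/-- **`Υ^{3D}_∞ > 0 ⇒` the periodic susceptibility `χ^{3D,per}_L(0)` is unbounded in `L`.**
[cite: Simon1980CMP, Thm 1.3; Lieb1980, Theorem 4 and p. 128; FisherBarberJasnow1973 §II] -/
theorem torus_susceptibility_unbounded_of_layeredStiffnessLiminf_pos (hp : 0 ≤ Kp) (hz : 0 ≤ Kz) {i : Fin 3}
    (h : 0 < layeredStiffnessLiminf Kp Kz i) :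
    ¬ ∃ (B : ℝ) (L₀ : ℕ), ∀ (L : ℕ) [NeZero L], L₀ ≤ L → ∑ y : TorusSite 3 L, corr (layeredCoupling Kp Kz) 0 y ≤ B := by
  intro hχ
  refine not_tendsto_torusXYDirStiffness_of_layeredStiffnessLiminf_pos h ?_
  have hχ' : ∃ (B : ℝ) (L₀ : ℕ), ∀ (L : ℕ) [NeZero L], L₀ ≤ L →
      ∑ y : TorusSite 3 L, corr (layeredCoupling (1 * Kp) (1 * Kz)) 0 y ≤ B := by simpa only [one_mul] using hχ
  simpa only [one_mul] using
    tendsto_torusXYDirStiffness_layered_of_torus_susceptibility_bounded zero_le_one hp hz hχ' i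

/-- **`Υ^{3D}_∞ > 0 ⇒` every cube number of the stack is `≥ 1`** (Lieb's finite algorithm never terminates).
[cite: Lieb1980, Theorem 4 and p. 128 (finite algorithm); FisherBarberJasnow1973 §II] -/
theorem one_le_cube_of_layeredStiffnessLiminf_pos (hp : 0 ≤ Kp) (hz : 0 ≤ Kz) {i : Fin 3}
    (h : 0 < layeredStiffnessLiminf Kp Kz i) {R : ℕ} (hR : 1 ≤ R) :
    1 ≤ aboxShellSum (fun u v : Site 3 => 1 / 2 * LongRangeIsing.layeredCoupling Kp Kz u v) (fun _ : Fin 3 => R) := by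
  by_contra hlt
  refine not_tendsto_torusXYDirStiffness_of_layeredStiffnessLiminf_pos h ?_
  simpa only [one_mul] using
    tendsto_torusXYDirStiffness_layered_of_cube_lt_one zero_le_one hp hz hR (lt_of_not_ge hlt) i

end Positive

/-! ## §4 The stiffness transition coupling `K_Υ^{3D}(Δ, i)` of the stack -/

section Transition

/-- **The stiffness transition coupling of the layered stack at anisotropy `Δ = J⊥/J∥` in the twist direction `eᵢ`**,
`K_Υ^{3D}(Δ, i) := inf {K ≥ 0 : Υ^{3D}_∞(K, ΔK, i) > 0} ∈ [0, ∞]` (in-plane reduced coupling `K = βJ∥`; `∞` if the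
stack stiffness vanishes at every coupling, which the tree does not exclude); in temperature units the stiffness
onset of the stack is `T_Υ^{3D}(J∥, ΔJ∥) = J∥/K_Υ^{3D}(Δ)`. The companion of `K_χ^{3D}(Δ)`
(`PlaneRotator.layeredSusceptibilityCriticalCoupling`) and of the single layer's `K_Υ` (`stiffnessCriticalCoupling`).
[cite: FisherBarberJasnow1973, §II eq. (2.5) (thermodynamic helicity modulus); LiuStanley1972, p. 272 (T_c(ε) of the layers (J, J, εJ))] -/
def layeredStiffnessCriticalCoupling (Δ : ℝ) (i : Fin 3) : ℝ≥0∞ :=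
  ⨅ (K : ℝ) (_ : 0 ≤ K ∧ 0 < layeredStiffnessLiminf K (Δ * K) i), ENNReal.ofReal K

variable {Δ : ℝ}

/-- A coupling with positive stack stiffness lies above `K_Υ^{3D}`: `0 ≤ K`, `Υ^{3D}_∞(K, ΔK, i) > 0 ⇒ K_Υ^{3D}(Δ, i) ≤ K`.
[cite: FisherBarberJasnow1973, §II eq. (2.5)] -/
theorem layeredStiffnessCriticalCoupling_le_ofReal {K : ℝ} {i : Fin 3} (hK : 0 ≤ K)
    (h : 0 < layeredStiffnessLiminf K (Δ * K) i) : layeredStiffnessCriticalCoupling Δ i ≤ ENNReal.ofReal K :=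
  iInf₂_le (f := fun K (_ : 0 ≤ K ∧ 0 < layeredStiffnessLiminf K (Δ * K) i) => ENNReal.ofReal K) K ⟨hK, h⟩

/-- **Below `K_Υ^{3D}` the stack carries no stiffness**: `0 ≤ Δ`, `0 ≤ K`, `K < K_Υ^{3D}(Δ, i) ⇒ Υ^{3D}_∞(K, ΔK, i) = 0`.
[cite: FisherBarberJasnow1973, §II eq. (2.5)] -/
theorem layeredStiffnessLiminf_eq_zero_of_ofReal_lt {K : ℝ} {i : Fin 3} (hΔ : 0 ≤ Δ) (hK : 0 ≤ K)
    (h : ENNReal.ofReal K < layeredStiffnessCriticalCoupling Δ i) : layeredStiffnessLiminf K (Δ * K) i = 0 := by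
  by_contra hne
  have hpos : 0 < layeredStiffnessLiminf K (Δ * K) i :=
    lt_of_le_of_ne (layeredStiffnessLiminf_nonneg hK (mul_nonneg hΔ hK) i) (Ne.symm hne)
  exact absurd h (not_lt.2 (layeredStiffnessCriticalCoupling_le_ofReal hK hpos))

/-- If `Υ^{3D}_∞(K, ΔK, i)` vanishes for all `0 ≤ K < c` then `c ≤ K_Υ^{3D}(Δ, i)`. [cite: FisherBarberJasnow1973, §II eq. (2.5)] -/
theorem ofReal_le_layeredStiffnessCriticalCoupling_of_forall_lt {c : ℝ} {i : Fin 3}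
    (h : ∀ K : ℝ, 0 ≤ K → K < c → layeredStiffnessLiminf K (Δ * K) i = 0) :
    ENNReal.ofReal c ≤ layeredStiffnessCriticalCoupling Δ i := by
  refine le_iInf₂ fun K hK => ENNReal.ofReal_le_ofReal ?_
  by_contra hlt
  exact hK.2.ne' (h K hK.1 (lt_of_not_ge hlt))

/-- **`K_χ^{3D}(Δ) ≤ K_Υ^{3D}(Δ, i)` for every anisotropy `Δ ≥ 0` and every twist direction — the stiffness onset of the
stack lies at or beyond its susceptibility transition coupling** (`T_Υ^{3D}(J∥, ΔJ∥) ≤ T_χ^{3D}(J∥, ΔJ∥)`, the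
structural half of `T_Υ = T_χ` for the stack): wherever `Υ^{3D}_∞ > 0` the free stack susceptibility is infinite
(`not_summable_layered_of_layeredStiffnessLiminf_pos`), and every such coupling bounds `K_χ^{3D}(Δ)` from above
(`layeredSusceptibilityCriticalCoupling_le_ofReal_of_not_summable`). [cite: Simon1980CMP, Thm 1.3; Lieb1980, Theorem 4 and p. 128; LiuStanley1972, p. 272] -/
theorem layeredSusceptibilityCriticalCoupling_le_layeredStiffnessCriticalCoupling (hΔ : 0 ≤ Δ) (i : Fin 3) :
    PlaneRotator.layeredSusceptibilityCriticalCoupling Δ ≤ layeredStiffnessCriticalCoupling Δ i :=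
  le_iInf₂ fun _ hK => layeredSusceptibilityCriticalCoupling_le_ofReal_of_not_summable hΔ hK.1
    (not_summable_layered_of_layeredStiffnessLiminf_pos hK.1 (mul_nonneg hΔ hK.1) hK.2)

/-- **No stack stiffness below the stack's susceptibility transition**: `0 ≤ Δ`, `0 ≤ K`, `K < K_χ^{3D}(Δ) ⇒
Υ^{3D}_∞(K, ΔK, i) = 0` (the stack susceptibility is finite there, `summable_layered_of_ofReal_lt`).
[cite: Simon1980CMP, Thm 1.3; Lieb1980, Theorem 4 and p. 128; LiuStanley1972, p. 272] -/
theorem layeredStiffnessLiminf_eq_zero_of_ofReal_lt_layeredSusceptibilityCriticalCoupling {K : ℝ} (hΔ : 0 ≤ Δ)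
    (hK : 0 ≤ K) (h : ENNReal.ofReal K < PlaneRotator.layeredSusceptibilityCriticalCoupling Δ) (i : Fin 3) :
    layeredStiffnessLiminf K (Δ * K) i = 0 :=
  layeredStiffnessLiminf_eq_zero_of_summable' hK (mul_nonneg hΔ hK) (summable_layered_of_ofReal_lt hΔ hK h) i

/-- **Lieb's star region lies below `K_Υ^{3D}(Δ, i)`**: `0 ≤ Δ`, `0 ≤ K`, `4K/√(K²+4) + 2ΔK/√((ΔK)²+4) < 1 ⇒
K ≤ K_Υ^{3D}(Δ, i)` (through `K ≤ K_χ^{3D}(Δ)`, `ofReal_le_layeredSusceptibilityCriticalCoupling_of_amos_star_lt_one`).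
[cite: Lieb1980, Theorem 4 (the star); Simon1980CMP, Thm 1.3; LiuStanley1972, p. 272] -/
theorem ofReal_le_layeredStiffnessCriticalCoupling_of_amos_star_lt_one {K : ℝ} (hΔ : 0 ≤ Δ) (hK : 0 ≤ K)
    (hm : 4 * (K / Real.sqrt (K ^ 2 + 4)) + 2 * (Δ * K / Real.sqrt ((Δ * K) ^ 2 + 4)) < 1) (i : Fin 3) :
    ENNReal.ofReal K ≤ layeredStiffnessCriticalCoupling Δ i :=
  (ofReal_le_layeredSusceptibilityCriticalCoupling_of_amos_star_lt_one hΔ hK hm).trans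
    (layeredSusceptibilityCriticalCoupling_le_layeredStiffnessCriticalCoupling hΔ i)

/-- **`K_Υ^{3D}(Δ, i) = ∞` iff `Υ^{3D}_∞(K, ΔK, i) = 0` for every `K ≥ 0`** (`Δ ≥ 0`; no stiffness transition of the
stack on the `K`-axis — not excluded by the tree). [cite: FisherBarberJasnow1973, §II eq. (2.5)] -/
theorem layeredStiffnessCriticalCoupling_eq_top_iff (hΔ : 0 ≤ Δ) (i : Fin 3) :
    layeredStiffnessCriticalCoupling Δ i = ⊤ ↔ ∀ K : ℝ, 0 ≤ K → layeredStiffnessLiminf K (Δ * K) i = 0 := by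
  constructor
  · intro h K hK
    exact layeredStiffnessLiminf_eq_zero_of_ofReal_lt hΔ hK (h ▸ ENNReal.ofReal_lt_top)
  · intro h
    unfold layeredStiffnessCriticalCoupling
    refine iInf_eq_top.2 fun K => iInf_eq_top.2 fun hK => ?_
    exact absurd (h K hK.1) hK.2.ne'

/-- **The isotropic point: `K_χ(3) ≤ K_Υ^{3D}(1, i)`** — for the nearest-neighbour XY model on `ℤ³` (`J⊥ = J∥`) the
stiffness onset lies at or beyond the susceptibility transition coupling `K_χ(3)` (`K_χ^{3D}(1) = K_χ(3)`,
`layeredSusceptibilityCriticalCoupling_one`), in every twist direction. [cite: Simon1980CMP, Thm 1.3; Lieb1980, Theorem 4 and p. 128; FisherBarberJasnow1973, §II eq. (2.5)] -/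
theorem susceptibilityCriticalCoupling_three_le_layeredStiffnessCriticalCoupling_one (i : Fin 3) :
    susceptibilityCriticalCoupling 3 ≤ layeredStiffnessCriticalCoupling 1 i := by
  rw [← layeredSusceptibilityCriticalCoupling_one]
  exact layeredSusceptibilityCriticalCoupling_le_layeredStiffnessCriticalCoupling zero_le_one i

/-- **`2β_c(3) ≤ K_Υ^{3D}(Δ, i)` for every `0 ≤ Δ ≤ 1`**: no stiffness onset of the stack inside the three-dimensional
Aizenman–Simon window (`2β_c(3) ≤ K_χ^{3D}(1) ≤ K_χ^{3D}(Δ) ≤ K_Υ^{3D}(Δ, i)`; in temperature units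
`T_Υ^{3D}(J∥, ΔJ∥) ≤ J∥/(2β_c(3))`). [cite: AizenmanSimon1980RotorIsing, eq. (2) (d = 3); LiuStanley1972, p. 272; FisherBarberJasnow1973, §II eq. (2.5)] -/
theorem two_mul_criticalBeta_three_le_layeredStiffnessCriticalCoupling (hΔ0 : 0 ≤ Δ) (hΔ1 : Δ ≤ 1) (i : Fin 3) :
    ENNReal.ofReal (2 * criticalBeta 3) ≤ layeredStiffnessCriticalCoupling Δ i :=
  (two_mul_criticalBeta_three_le_layeredSusceptibilityCriticalCoupling_one.trans
    (layeredSusceptibilityCriticalCoupling_mem_Icc hΔ0 hΔ1).1).trans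
    (layeredSusceptibilityCriticalCoupling_le_layeredStiffnessCriticalCoupling hΔ0 i)

/-- **The weak-interlayer limit: `K_χ(2) ≤ liminf_{Δ → 0⁺} K_Υ^{3D}(Δ, i)`** — since `K_χ^{3D}(Δ) ≤ K_Υ^{3D}(Δ, i)` for
every `Δ > 0` and `K_χ^{3D}(Δ) → K_χ(2)` as `Δ → 0⁺` (`tendsto_layeredSusceptibilityCriticalCoupling_zero`): the
stiffness onset of weakly coupled layers is bounded by the SINGLE LAYER's susceptibility transition,
`limsup_{J⊥ → 0⁺} T_Υ^{3D}(J∥, J⊥) ≤ T_χ^{2D}(J∥)` (the typed form of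
`exists_interlayer_window_layeredStiffnessLiminf_eq_zero_of_summable_layer`). [cite: LiuStanley1972, p. 272 (T_c(ε) → T_c^{2D} as ε → 0); Simon1980CMP, Thm 1.3; Lieb1980, Theorem 4 and p. 128] -/
theorem susceptibilityCriticalCoupling_two_le_liminf_layeredStiffnessCriticalCoupling (i : Fin 3) :
    susceptibilityCriticalCoupling 2 ≤ Filter.liminf (fun Δ : ℝ => layeredStiffnessCriticalCoupling Δ i) (𝓝[>] 0) := by
  rw [← tendsto_layeredSusceptibilityCriticalCoupling_zero.liminf_eq]
  refine Filter.liminf_le_liminf ?_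
  filter_upwards [self_mem_nhdsWithin] with Δ hΔ
  exact layeredSusceptibilityCriticalCoupling_le_layeredStiffnessCriticalCoupling (le_of_lt hΔ) i

/-! ### The decoupled point: `K_Υ^{3D}(0, e₁) = K_Υ`, `K_Υ^{3D}(0, e₃) = ∞` -/

/-- **The decoupled stack's in-plane stiffness transition IS the single layer's: `K_Υ^{3D}(0, e₁) = K_Υ`**
(`Υ^{3D}_∞(K, 0, e₁) = Υ_∞(K)` for every `K`, `layeredStiffnessLiminf_zero_inPlane`) — the `J⊥ = 0` end of the
2D → 3D comparison in stiffness currency, beside `K_χ^{3D}(0) = K_χ(2)` (`layeredSusceptibilityCriticalCoupling_zero`).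
[cite: FisherBarberJasnow1973, §II eq. (2.5); LiuStanley1972, p. 272 (ε = 0: independent layers)] -/
theorem layeredStiffnessCriticalCoupling_zero_inPlane : layeredStiffnessCriticalCoupling 0 0 = stiffnessCriticalCoupling := by
  unfold layeredStiffnessCriticalCoupling stiffnessCriticalCoupling
  simp only [zero_mul, layeredStiffnessLiminf_zero_inPlane]

/-- **No c-axis stiffness transition without interlayer coupling: `K_Υ^{3D}(0, e₃) = ∞`** (`Υ^{3D}_∞(K, 0, e₃) = 0` for
every `K`). [cite: FisherBarberJasnow1973, §II eq. (2.5); LiuStanley1972, p. 272 (ε = 0)] -/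
theorem layeredStiffnessCriticalCoupling_zero_cAxis : layeredStiffnessCriticalCoupling 0 2 = ⊤ :=
  (layeredStiffnessCriticalCoupling_eq_top_iff le_rfl 2).2 fun K _ => by
    rw [zero_mul, layeredStiffnessLiminf_zero_cAxis]

/-- At `Δ = 0`, in-plane: `K_χ(2) ≤ K_Υ^{3D}(0, e₁)` (`= K_Υ`; the single layer's `T_Υ ≤ T_χ`,
`susceptibilityCriticalCoupling_two_le_stiffnessCriticalCoupling`). [cite: Simon1980CMP, Thm 1.3; Lieb1980, p. 128 (boxes)] -/
theorem susceptibilityCriticalCoupling_two_le_layeredStiffnessCriticalCoupling_zero :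
    susceptibilityCriticalCoupling 2 ≤ layeredStiffnessCriticalCoupling 0 0 := by
  rw [layeredStiffnessCriticalCoupling_zero_inPlane]
  exact susceptibilityCriticalCoupling_two_le_stiffnessCriticalCoupling

/-- **`2β_c(2) ≤ K_Υ^{3D}(0, e₁)`**: no in-plane stiffness transition of the decoupled stack inside Aizenman–Simon's
window. [cite: AizenmanSimon1980RotorIsing, eq. (2); FisherBarberJasnow1973, §II eq. (2.5)] -/
theorem two_mul_criticalBeta_two_le_layeredStiffnessCriticalCoupling_zero :
    ENNReal.ofReal (2 * criticalBeta 2) ≤ layeredStiffnessCriticalCoupling 0 0 := by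
  rw [layeredStiffnessCriticalCoupling_zero_inPlane]
  exact two_mul_criticalBeta_two_le_stiffnessCriticalCoupling

/-- **`log(1+√2) ≤ K_Υ^{3D}(0, e₁)`** (`T_Υ^{3D}(J∥, 0) ≤ J∥/log(1+√2) < 1.1346·J∥`). [cite: AizenmanSimon1980RotorIsing, eq. (2) (β_c^I = ½ln(1+√2) in d = 2); FisherBarberJasnow1973, §II eq. (2.5)] -/
theorem log_one_add_sqrt_two_le_layeredStiffnessCriticalCoupling_zero :
    ENNReal.ofReal (Real.log (1 + Real.sqrt 2)) ≤ layeredStiffnessCriticalCoupling 0 0 := by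
  rw [layeredStiffnessCriticalCoupling_zero_inPlane]
  exact log_one_add_sqrt_two_le_stiffnessCriticalCoupling

/-! ### Temperature forms -/

/-- **`T_Υ^{3D}(J∥, ΔJ∥) ≤ T_χ^{3D}(J∥, ΔJ∥)`** for every `Δ ≥ 0` and every twist direction, with
`T_Υ^{3D} := J∥/K_Υ^{3D}(Δ, i)` and `T_χ^{3D} := J∥/K_χ^{3D}(Δ)` (extended-real quotients; `J∥/∞ = 0` = «no onset at
any positive temperature»): the stiffness onset temperature of the stack lies at or below its susceptibility transition
temperature. [cite: Simon1980CMP, Thm 1.3; Lieb1980, Theorem 4 and p. 128; FisherBarberJasnow1973, §II eq. (2.5); LiuStanley1972, p. 272] -/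
theorem layeredStiffnessTemperature_le_layeredSusceptibilityTemperature (J : ℝ) (hΔ : 0 ≤ Δ) (i : Fin 3) :
    ENNReal.ofReal J / layeredStiffnessCriticalCoupling Δ i ≤
      ENNReal.ofReal J / PlaneRotator.layeredSusceptibilityCriticalCoupling Δ :=
  ENNReal.div_le_div_left (layeredSusceptibilityCriticalCoupling_le_layeredStiffnessCriticalCoupling hΔ i) _

/-- **`T_Υ^{3D}(J, 0·J) = T_Υ^{2D}(J)`** in-plane: at zero interlayer coupling the stack's in-plane stiffness onset
temperature is the layer's. [cite: FisherBarberJasnow1973, §II eq. (2.5); LiuStanley1972, p. 272 (ε = 0)] -/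
theorem layeredStiffnessTemperature_zero_inPlane (J : ℝ) :
    ENNReal.ofReal J / layeredStiffnessCriticalCoupling 0 0 = ENNReal.ofReal J / stiffnessCriticalCoupling := by
  rw [layeredStiffnessCriticalCoupling_zero_inPlane]

/-- **`T_Υ^{3D}(J∥, 0) ≤ J∥/(2β_c(2))`** in-plane (`≤ 1.1346·J∥`). [cite: AizenmanSimon1980RotorIsing, eq. (2); FisherBarberJasnow1973, §II eq. (2.5)] -/
theorem layeredStiffnessTemperature_zero_inPlane_le (J : ℝ) :
    ENNReal.ofReal J / layeredStiffnessCriticalCoupling 0 0 ≤ ENNReal.ofReal (J / (2 * criticalBeta 2)) := by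
  rw [layeredStiffnessTemperature_zero_inPlane]
  exact stiffnessTemperature_le J

end Transition

end AnisotropicRotator

end Literature.Probability.LatticeModels
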